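/-
Copyright (c) 2026 the pub-hodgecm-mathlib formalisation cell (harness21).  Prover seat hodgecm-mathlib-F0P3a-p01 (g37), FLOOR 0, SUPPORTS-ONLY on h413; β-BOARD v1 R10
(assembler): the `hRest` glue, part 3 (tower 2) — the DISPATCHER of the rest shapes of tower 2 onto the row heads (★ cell zero, R7 A∕B∕C twins, A′ tower 2, R6 twin).  2026-09-04.
-/
import Summits.HodgeConjecture.HodgeConjecture.Theorems.F0P3cDyRamLabelledOddGluedOffFootHighG2   -- ★-pending p861597 (this seat): A′ tower 2; brings ★ p860856 (G₂ cell column + zero-twin)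
import Summits.HodgeConjecture.HodgeConjecture.Theorems.F0P3cDyRamStageOneBDefs               -- ★ DEFS №5: `mcOfRecord`
import Summits.HodgeConjecture.HodgeConjecture.Theorems.F0P3cDyRamElementDatumParity          -- ★: `isoceles_of_isElementDatum`, `depth_mod_two_eq_of_isElementDatum`
import HarnessLib

/-!
# Crux `H413`, LH4 «(D-RAM) FOUR-FRAME» road, STAGE 1b (β) — THE `hRest` GLUE, PART 3 (TOWER 2): THE TOWER-2 DISPATCHER — every NON-TUBE glued stratum `![2ρ+s, 2ρ, 2ρ+s]` gets its
# value from exactly one of {★ p860856 cell zero, R7-A₂, A′₂ (★-pending p861597), R7-B₂, R7-C₂, R6₂}, giving the socket letter `VG 1 ρ s = [2ρ+ℓ₀ = n₁ ∧ n₂ ≠ n₁+s]·κ ρ s`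

Cell `hodgecm-mathlib` (D-0151), FLOOR 0, crux item H413 = `stmt-HodgeConjecture-24833`, route `HCCMUnconditional`; squad F0∕P3c∕LH4.  THEOREMS ONLY (no `def`, no instance, no
notation, no `sorry`, default heartbeats); lane `--supports stmt-HodgeConjecture-24833 --as helper` (count-neutral; pays NO row).

THE DISPATCH = the (0 1)-swap twin of ★-pending p861555 (tower 1): letters `read := 2ρ+s+ℓ₀ = n₂`, `cap := 2ρ+2+ℓ₀ ≤ min n₁ n₃`, cell `2ρ + m* ≤ n₁` (★ p860856 token-free zero),
foot `n₂ = n₁ + s`, κ-locus `2ρ+ℓ₀ = n₁`, top classes `2n₁ < 2ρ+mc`, window `n₁ ≤ 2ρ+ℓ₀ ∧ 2ρ+mc ≤ 2n₁`, A′ tower 2 (`min n₁ n₃ < 2ρ`, ★-pending p861597); same five cases.  The four row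
statements R7-A₂∕B₂∕C₂ and R6₂ enter as HYPOTHESES in the swapped SIG-R7 §2 shapes (LH7-p05 ED. 2 ∕ LH4-p18 swap01 engine; R6₂ with a free closed form `κ`); at assembly the ★
names are passed in.
HONEST LABEL.  Count-neutral dispatcher; R6₂∕R7-A₂∕B₂∕C₂ are hypotheses here; `hRest`, (β) OPEN; `HC_CM` is proved only modulo the 7 printed
citations (2 remaining named inputs: hLiu418 = `stmt-HodgeConjecture-24832`, h413 = `stmt-HodgeConjecture-24833`) until rung 0 closes.

## References
* [Kottwitz1986BaseChangeUnits] R. E. Kottwitz, *Base change for unit elements of Hecke algebras*, Compositio Math. 60 (1986), §1 pp. 240–241 (lattice counts by strata).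
* [Rogawski1990] J. D. Rogawski, *Automorphic Representations of Unitary Groups in Three Variables*, Ann. of Math. Stud. 123 (1990), §4.9 Prop. 4.9.1 (a)(b) p. 55.
-/

set_option autoImplicit false

noncomputable section

namespace Summit.HodgeConjecture.HodgeConjecture.Cruxes.H413.F0P3cDyRamLabelledOddRestDispatchG2

open Literature.NumberTheory.Automorphic Literature.NumberTheory.Automorphic.HermitianLattice
open Literature.NumberTheory.Automorphic.UnitaryLatticeTree Literature.NumberTheory.Automorphic.UnitaryThreeFourFrame
open Summit.HodgeConjecture.HodgeConjecture.Cruxes.H413.F0P3cDyRamFourFramePieces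
open Summit.HodgeConjecture.HodgeConjecture.Cruxes.H413.F0P3cDyRamFourFrameCensusDefs
open Summit.HodgeConjecture.HodgeConjecture.Cruxes.H413.F0P3cDyRamStageOneBDefs (mcOfRecord)
open Summit.HodgeConjecture.HodgeConjecture.Cruxes.H413.F0P3cDyRamDiagonalTorusDefs
open Summit.HodgeConjecture.HodgeConjecture.Cruxes.H413.F0P3cDyRamDiagonalStrataDefs
open Summit.HodgeConjecture.HodgeConjecture.Cruxes.H413.F0P3cDyRamLabelledOddCountDefs
open Summit.HodgeConjecture.HodgeConjecture.Cruxes.H413.F0P3cDyRamLabelledOddPureStrataG2 (finsum_stratum_G2_shell_labelledOdd_div_relIndex_eq_zero_of_not)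
open Summit.HodgeConjecture.HodgeConjecture.Cruxes.H413.F0P3cDyRamLabelledOddGluedOffFootHighG2 (finsum_stratum_G2_shell_labelledOdd_div_relIndex_eq_zero_of_offFoot_of_lt)
open Summit.HodgeConjecture.HodgeConjecture.Cruxes.H413.F0P3cDyRamElementDatumParity (isoceles_of_isElementDatum depth_mod_two_eq_of_isElementDatum)
open scoped Valued WithZero Matrix MatrixGroups

variable {K : Type} [Field K] [Valued K ℤᵐ⁰] {σ : K →+* K} {ϖ : K} {d t : ℕ} {α β : K} {N₀ n₁ n₂ n₃ : ℕ}

/-- **THE TOWER-2 REST DISPATCHER** ((0 1)-swap twin of `restValue_G1_of_rows`).  At a ramified datum with `|2| < 1` and an element datum at `N₀ ≥ mcOfRecord d, d`, `T = diag(α,β,1)`: given the four row statements of the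
β-BOARD for tower 2 — R7-A₂ (off foot `n₂ ≠ n₁ + s`, off both reads ⇒ 0), R7-B₂, R7-C₂ and R6₂ (κ-locus `2ρ+ℓ₀ = n₁` off the foot ⇒ `κ ρ s i`) — every NON-TUBE glued stratum
`![2ρ+s, 2ρ, 2ρ+s]` (`ρ, s ≥ 1`, `2 ∣ s`, `¬(2ρ+s+ℓ₀ = n₂ ∧ 2ρ+2+ℓ₀ ≤ min n₁ n₃)`) carries the clean-shell labelled-odd table `if 2ρ + d%2 = n₁ ∧ n₂ ≠ n₁ + s then κ ρ s i else 0` — the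
socket letter `VG 1` of ★ `…OddLabelledRestReindex.sum_box_restShape_eq_of_rows`.
[cite: Kottwitz1986BaseChangeUnits, §1 pp. 240–241] [cite: Rogawski1990, §4.9 Prop. 4.9.1 (a)(b) p. 55] -/
theorem restValue_G2_of_rows (hD : IsRamifiedQuadraticDatum σ ϖ d t) (h2d : 2 ≤ d)
    (hE : IsElementDatum σ ϖ N₀ α β n₁ n₂ n₃) (hdN₀ : d ≤ N₀) (hmc : mcOfRecord d ≤ N₀)
    (T : GL (Fin 3) K) (hT : (T : Matrix (Fin 3) (Fin 3) K) = Matrix.diagonal ![α, β, 1]) (κ : ℕ → ℕ → Fin 3 → ℚ)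
    (hA : ∀ (ρ s : ℕ), 1 ≤ ρ → 1 ≤ s → n₂ ≠ n₁ + s → 2 * ρ + s + d % 2 ≠ n₂ → 2 * ρ + d % 2 ≠ n₁ → ∀ i : Fin 3,
      ∑ᶠ M ∈ {M : Submodule 𝒪[K] (Fin 3 → K) | M ∈ stratum σ ϖ T ![2 * ρ + s, 2 * ρ, 2 * ρ + s] ∧
          (LatticeInLevel ϖ (d % 2) (Matrix.diagonal ![α - 1, β - 1, 0]) M ∧ ¬ LatticeInLevel ϖ (d % 2 + 1) (Matrix.diagonal ![α - 1, β - 1, 0]) M ∧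
            LatticeInLevel ϖ (mcOfRecord d) (Matrix.diagonal ![(α - 1) * (α - 1), (β - 1) * (β - 1), 0]) M)},
        (labelledOddCount σ ϖ 0 i (valueClassLabel σ ϖ (α - 1) (β - 1) (mstarOfRecord d) d) M : ℚ) /
          ((((unitStabilizer M).map (unitNormMap σ 3)).relIndex (fixedUnitTorus σ 3) : ℕ) : ℚ) = 0)
    (hB : ∀ (ρ s : ℕ), 1 ≤ ρ → 1 ≤ s → n₂ = n₁ + s → (2 * ρ + d % 2 + 2 ≤ n₁ ∨ 2 * n₁ < 2 * ρ + mcOfRecord d) → ∀ i : Fin 3,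
      ∑ᶠ M ∈ {M : Submodule 𝒪[K] (Fin 3 → K) | M ∈ stratum σ ϖ T ![2 * ρ + s, 2 * ρ, 2 * ρ + s] ∧
          (LatticeInLevel ϖ (d % 2) (Matrix.diagonal ![α - 1, β - 1, 0]) M ∧ ¬ LatticeInLevel ϖ (d % 2 + 1) (Matrix.diagonal ![α - 1, β - 1, 0]) M ∧
            LatticeInLevel ϖ (mcOfRecord d) (Matrix.diagonal ![(α - 1) * (α - 1), (β - 1) * (β - 1), 0]) M)},
        (labelledOddCount σ ϖ 0 i (valueClassLabel σ ϖ (α - 1) (β - 1) (mstarOfRecord d) d) M : ℚ) /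
          ((((unitStabilizer M).map (unitNormMap σ 3)).relIndex (fixedUnitTorus σ 3) : ℕ) : ℚ) = 0)
    (hC : ∀ (ρ s : ℕ), 1 ≤ ρ → 1 ≤ s → n₂ = n₁ + s → n₁ ≤ 2 * ρ + d % 2 → 2 * ρ + mcOfRecord d ≤ 2 * n₁ → ∀ i : Fin 3,
      ∑ᶠ M ∈ {M : Submodule 𝒪[K] (Fin 3 → K) | M ∈ stratum σ ϖ T ![2 * ρ + s, 2 * ρ, 2 * ρ + s] ∧
          (LatticeInLevel ϖ (d % 2) (Matrix.diagonal ![α - 1, β - 1, 0]) M ∧ ¬ LatticeInLevel ϖ (d % 2 + 1) (Matrix.diagonal ![α - 1, β - 1, 0]) M ∧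
            LatticeInLevel ϖ (mcOfRecord d) (Matrix.diagonal ![(α - 1) * (α - 1), (β - 1) * (β - 1), 0]) M)},
        (labelledOddCount σ ϖ 0 i (valueClassLabel σ ϖ (α - 1) (β - 1) (mstarOfRecord d) d) M : ℚ) /
          ((((unitStabilizer M).map (unitNormMap σ 3)).relIndex (fixedUnitTorus σ 3) : ℕ) : ℚ) = 0)
    (hR6 : ∀ (ρ s : ℕ), 1 ≤ ρ → 1 ≤ s → 2 ∣ s → 2 * ρ + d % 2 = n₁ → n₂ ≠ n₁ + s → ∀ i : Fin 3,
      ∑ᶠ M ∈ {M : Submodule 𝒪[K] (Fin 3 → K) | M ∈ stratum σ ϖ T ![2 * ρ + s, 2 * ρ, 2 * ρ + s] ∧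
          (LatticeInLevel ϖ (d % 2) (Matrix.diagonal ![α - 1, β - 1, 0]) M ∧ ¬ LatticeInLevel ϖ (d % 2 + 1) (Matrix.diagonal ![α - 1, β - 1, 0]) M ∧
            LatticeInLevel ϖ (mcOfRecord d) (Matrix.diagonal ![(α - 1) * (α - 1), (β - 1) * (β - 1), 0]) M)},
        (labelledOddCount σ ϖ 0 i (valueClassLabel σ ϖ (α - 1) (β - 1) (mstarOfRecord d) d) M : ℚ) /
          ((((unitStabilizer M).map (unitNormMap σ 3)).relIndex (fixedUnitTorus σ 3) : ℕ) : ℚ) = κ ρ s i)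
    (ρ s : ℕ) (hρ : 1 ≤ ρ) (hs : 1 ≤ s) (h2s : 2 ∣ s) (hnt : ¬ (2 * ρ + s + d % 2 = n₂ ∧ 2 * ρ + 2 + d % 2 ≤ min n₁ n₃)) (i : Fin 3) :
    ∑ᶠ M ∈ {M : Submodule 𝒪[K] (Fin 3 → K) | M ∈ stratum σ ϖ T ![2 * ρ + s, 2 * ρ, 2 * ρ + s] ∧
        (LatticeInLevel ϖ (d % 2) (Matrix.diagonal ![α - 1, β - 1, 0]) M ∧ ¬ LatticeInLevel ϖ (d % 2 + 1) (Matrix.diagonal ![α - 1, β - 1, 0]) M ∧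
          LatticeInLevel ϖ (mcOfRecord d) (Matrix.diagonal ![(α - 1) * (α - 1), (β - 1) * (β - 1), 0]) M)},
      (labelledOddCount σ ϖ 0 i (valueClassLabel σ ϖ (α - 1) (β - 1) (mstarOfRecord d) d) M : ℚ) /
        ((((unitStabilizer M).map (unitNormMap σ 3)).relIndex (fixedUnitTorus σ 3) : ℕ) : ℚ) =
      if 2 * ρ + d % 2 = n₁ ∧ n₂ ≠ n₁ + s then κ ρ s i else 0 := by
  -- letters of the datum
  have hiso := isoceles_of_isElementDatum hD hE
  obtain ⟨hp1, hp2, hp3⟩ := depth_mod_two_eq_of_isElementDatum hD hE hdN₀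
  have hn₁ : N₀ ≤ n₁ := hE.2.2.2.2.2.2.2.2.1
  have hn₂ : N₀ ≤ n₂ := hE.2.2.2.2.2.2.2.2.2.1
  have hn₃ : N₀ ≤ n₃ := hE.2.2.2.2.2.2.2.2.2.2
  have hms : mstarOfRecord d = d % 2 + 2 * d - 1 := rfl
  have hmcv : mcOfRecord d = 2 * ((d % 2 + 2 * d - 1 + d) / 2) := rfl
  have hd2 := Nat.mod_two_eq_zero_or_one d
  by_cases hcell : 2 * ρ + mstarOfRecord d ≤ n₁
  · -- (1) the one-slot cell: read ⇒ cap, hence ¬read; ★ p860827's token-free zero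
    have hcell' := hcell
    rw [hms] at hcell'
    have hnot : ¬ (2 * ρ + s + d % 2 = n₂ ∧ 2 ∣ s ∧ 2 * ρ ≤ min n₁ n₃) := by
      rintro ⟨hread, -, -⟩
      apply hnt
      refine ⟨hread, ?_⟩
      rcases hiso with ⟨h12, h13⟩ | ⟨h13, h12⟩ | ⟨h23, h21⟩
      · rw [le_min_iff]; constructor <;> omega
      · rw [le_min_iff]; constructor <;> omega
      · rw [le_min_iff]; constructor <;> omega
    rw [finsum_stratum_G2_shell_labelledOdd_div_relIndex_eq_zero_of_not hD h2d hE hmc T hT ρ s hρ hs hcell hnot i]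
    rw [if_neg]
    rintro ⟨hκ, -⟩
    omega
  · rw [hms] at hcell
    by_cases hκ : 2 * ρ + d % 2 = n₁
    · by_cases hfoot : n₂ = n₁ + s
      · -- (2b) on the foot at the κ-locus: R7-C
        rw [hC ρ s hρ hs hfoot (by omega) (by rw [hmcv]; omega) i, if_neg]
        exact fun h => h.2 hfoot
      · -- (2a) off the foot at the κ-locus: R6
        rw [hR6 ρ s hρ hs h2s hκ hfoot i, if_pos ⟨hκ, hfoot⟩]
    · rw [if_neg (fun h => hκ h.1)]
      by_cases hfoot : n₂ = n₁ + s
      · -- (3) on the foot, off the κ-locus: R7-B or R7-C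
        by_cases hoff : 2 * ρ + d % 2 + 2 ≤ n₁ ∨ 2 * n₁ < 2 * ρ + mcOfRecord d
        · exact hB ρ s hρ hs hfoot hoff i
        · rw [not_or, not_le, not_lt] at hoff
          exact hC ρ s hρ hs hfoot (by omega) hoff.2 i
      · by_cases hread : 2 * ρ + s + d % 2 = n₂
        · -- (4b) off the foot, off the κ-locus, read TRUE: ¬cap ⇒ min n₁ n₃ < 2ρ ⇒ A′
          have hcap : ¬ 2 * ρ + 2 + d % 2 ≤ min n₁ n₃ := fun h => hnt ⟨hread, h⟩
          have hlt : min n₁ n₃ < 2 * ρ := by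
            rw [not_le] at hcap
            rcases le_total n₁ n₃ with h13 | h31
            · rw [min_eq_left h13] at hcap ⊢
              rcases hiso with ⟨h12, -⟩ | ⟨h13', -⟩ | ⟨h23, h21⟩ <;> omega
            · rw [min_eq_right h31] at hcap ⊢
              rcases hiso with ⟨h12, h13⟩ | ⟨h13', h12⟩ | ⟨h23, h21⟩ <;> omega
          exact finsum_stratum_G2_shell_labelledOdd_div_relIndex_eq_zero_of_offFoot_of_lt hD hE T hT ρ s hρ hs hfoot hlt _ i _
        · -- (4a) off the foot, off both reads: R7-A
          exact hA ρ s hρ hs hfoot hread hκ i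

end Summit.HodgeConjecture.HodgeConjecture.Cruxes.H413.F0P3cDyRamLabelledOddRestDispatchG2

end
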